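import Mathlib

/-!
# Crux `MonotoneSuffices` (stmt-PneNP-18026), line `Sketch` — scope of the SHIFT lever, part 1:
# the hybrid bound on the entry gain of an up-shift

An UP-SHIFT of the cube `α → Bool` by a set `R` of coordinates is `x ↦ x ∨ 1_R`
(`fun a => x a || decide (a ∈ R)`); the negation ladder of line `Sketch` uses random up-shifts to push
both laws of the crux into the up-set `U = {g = 1}` of a negated monotone coin `g`. How much mass can a
shift move into `U`? Forcing the coordinates of `R` one at a time (a hybrid argument):

* `card_upShift_insert_eq` — for monotone `U`, forcing one more coordinate `e` on top of `T` adds exactly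
  the GAIN SET `{x : U(x ∨ 1_{T+e}) ∧ ¬ U(x ∨ 1_T)}`;
* `card_upShift_le_of_gain` — if every single-coordinate gain on top of every upward restriction is
  `≤ G`, then `#{x : U(x ∨ 1_R)} ≤ #{x : U x} + #R · G` for every `R`;
* `sum_card_upShift_le_of_gain` — the same averaged over any finitely supported shift law
  (weights `w i ≥ 0` on sets `Rf i`): the total entry gain is at most `G · ∑ w i · #(Rf i)`.

With `G = 2^{N-1} · I⁺(U)` (`I⁺` = the largest influence of a coordinate in an UPWARD restriction of
`U`) this is the inequality `E_{x,R}[U(x ∨ 1_R)] - μ(U) ≤ ½ I⁺(U) · E|R|` of the evidence memo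
`session4-shift-levers.md` (§2): coins of small restricted influence cannot be entered by short shifts.
-/

set_option linter.dupNamespace false -- `Summit.PneNP.PneNP.…`: summit = sub-problem name (D-0017 single-conjunct layout)

namespace Summit.PneNP.PneNP.Theorems.MonotoneSuffices.ShiftNoGo

open Finset

variable {α : Type*} [DecidableEq α]

/-! ### Up-shifts -/

/-- The empty up-shift is the identity: `x ∨ 1_∅ = x`. [folklore] -/
theorem upShift_empty (x : α → Bool) : (fun a => x a || decide (a ∈ (∅ : Finset α))) = x := by
  funext a
  simp

/-- Up-shifts compose: `(x ∨ 1_T) ∨ 1_{e} = x ∨ 1_{T+e}`. [folklore] -/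
theorem upShift_insert (x : α → Bool) (T : Finset α) (e : α) :
    (fun a => x a || decide (a ∈ insert e T)) =
      fun a => (x a || decide (a ∈ T)) || decide (a = e) := by
  funext a
  by_cases ha : a = e
  · subst ha; simp
  · simp [ha]

/-- An up-shift only raises the point: `x ≤ x ∨ 1_R`. [folklore] -/
theorem le_upShift (x : α → Bool) (R : Finset α) : x ≤ fun a => x a || decide (a ∈ R) :=
  fun _ => Bool.left_le_or _ _

/-- A larger shift set raises more: `x ∨ 1_T ≤ x ∨ 1_{T+e}`. [folklore] -/
theorem upShift_le_upShift_insert (x : α → Bool) (T : Finset α) (e : α) :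
    (fun a => x a || decide (a ∈ T)) ≤ fun a => x a || decide (a ∈ insert e T) := by
  intro a
  by_cases haT : a ∈ T
  · simp [haT]
  · simp only [haT, decide_false, Bool.or_false, mem_insert, or_false]
    exact Bool.left_le_or _ _

/-! ### The hybrid bound -/

/-- **One hybrid step, exactly.** For monotone `U`, forcing one more coordinate adds exactly the gain
set: `#{x : U(x ∨ 1_{T+e})} = #{x : U(x ∨ 1_T)} + #{x : U(x ∨ 1_{T+e}) ∧ ¬ U(x ∨ 1_T)}`. [folklore] -/
theorem card_upShift_insert_eq [Fintype α] (U : (α → Bool) → Bool) (hU : Monotone U) (T : Finset α) (e : α) :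
    #((univ : Finset (α → Bool)).filter fun x => U (fun a => x a || decide (a ∈ insert e T)) = true) =
      #((univ : Finset (α → Bool)).filter fun x => U (fun a => x a || decide (a ∈ T)) = true) +
      #((univ : Finset (α → Bool)).filter fun x => U (fun a => x a || decide (a ∈ insert e T)) = true ∧
        U (fun a => x a || decide (a ∈ T)) = false) := by
  rw [← card_union_of_disjoint]
  · congr 1
    ext x
    simp only [mem_filter, mem_univ, true_and, mem_union]
    constructor
    · intro h
      by_cases hT : U (fun a => x a || decide (a ∈ T)) = true
      · exact Or.inl hT
      · exact Or.inr ⟨h, by simpa using hT⟩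
    · rintro (h | ⟨h, -⟩)
      · have hle := hU (upShift_le_upShift_insert x T e)
        rw [h] at hle
        exact Bool.eq_true_of_true_le hle
      · exact h
  · rw [disjoint_filter]
    intro x _ h1 h2
    rw [h1] at h2
    exact Bool.noConfusion h2.2

/-- **The hybrid bound.** If every single-coordinate gain on top of every upward restriction of `U` is
at most `G` — `#{x : U(x ∨ 1_{T+e}) ∧ ¬ U(x ∨ 1_T)} ≤ G` for all `T, e` — then for every shift set `R`,
`#{x : U(x ∨ 1_R)} ≤ #{x : U x} + #R · G` (`U` monotone). [folklore] -/
theorem card_upShift_le_of_gain [Fintype α] (U : (α → Bool) → Bool) (hU : Monotone U) (G : ℕ)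
    (hG : ∀ (T : Finset α) (e : α), e ∉ T →
      #((univ : Finset (α → Bool)).filter fun x => U (fun a => x a || decide (a ∈ insert e T)) = true ∧
        U (fun a => x a || decide (a ∈ T)) = false) ≤ G)
    (R : Finset α) :
    #((univ : Finset (α → Bool)).filter fun x => U (fun a => x a || decide (a ∈ R)) = true) ≤
      #((univ : Finset (α → Bool)).filter fun x => U x = true) + #R * G := by
  induction R using Finset.induction_on with
  | empty =>
    simp only [card_empty, zero_mul, add_zero]
    refine le_of_eq (congrArg Finset.card (filter_congr fun x _ => ?_))
    rw [upShift_empty]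
  | insert e T heT ih =>
    rw [card_upShift_insert_eq U hU T e, card_insert_of_notMem heT]
    calc #((univ : Finset (α → Bool)).filter fun x => U (fun a => x a || decide (a ∈ T)) = true) +
          #((univ : Finset (α → Bool)).filter fun x => U (fun a => x a || decide (a ∈ insert e T)) = true ∧
            U (fun a => x a || decide (a ∈ T)) = false)
        ≤ (#((univ : Finset (α → Bool)).filter fun x => U x = true) + #T * G) + G := add_le_add ih (hG T e heT)
      _ = _ := by ring

/-- **The hybrid bound, averaged over a shift law.** For weights `w i ≥ 0` on shift sets `Rf i`
(a finitely supported law on shifts, not necessarily normalised):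
`∑ w i · #{x : U(x ∨ 1_{Rf i})} ≤ (∑ w i) · #{x : U x} + G · ∑ w i · #(Rf i)`. [folklore] -/
theorem sum_card_upShift_le_of_gain [Fintype α] {ι : Type*} (s : Finset ι) (w : ι → ℝ) (hw : ∀ i ∈ s, 0 ≤ w i)
    (Rf : ι → Finset α) (U : (α → Bool) → Bool) (hU : Monotone U) (G : ℕ)
    (hG : ∀ (T : Finset α) (e : α), e ∉ T →
      #((univ : Finset (α → Bool)).filter fun x => U (fun a => x a || decide (a ∈ insert e T)) = true ∧
        U (fun a => x a || decide (a ∈ T)) = false) ≤ G) :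
    ∑ i ∈ s, w i * (#((univ : Finset (α → Bool)).filter fun x => U (fun a => x a || decide (a ∈ Rf i)) = true) : ℝ) ≤
      (∑ i ∈ s, w i) * #((univ : Finset (α → Bool)).filter fun x => U x = true) +
        (G : ℝ) * ∑ i ∈ s, w i * #(Rf i) := by
  rw [sum_mul, mul_sum, ← sum_add_distrib]
  refine sum_le_sum fun i hi => ?_
  have h := card_upShift_le_of_gain U hU G hG (Rf i)
  have h' : (#((univ : Finset (α → Bool)).filter fun x => U (fun a => x a || decide (a ∈ Rf i)) = true) : ℝ) ≤
      #((univ : Finset (α → Bool)).filter fun x => U x = true) + #(Rf i) * G := by exact_mod_cast h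
  calc w i * (#((univ : Finset (α → Bool)).filter fun x => U (fun a => x a || decide (a ∈ Rf i)) = true) : ℝ)
      ≤ w i * (#((univ : Finset (α → Bool)).filter fun x => U x = true) + #(Rf i) * G) :=
        mul_le_mul_of_nonneg_left h' (hw i hi)
    _ = _ := by ring

/-- **shift_hybrid** (registered helper sub-goal of stmt-PneNP-18026, scope of the shift lever, part 1):
the averaged hybrid bound `sum_card_upShift_le_of_gain`. [folklore] -/
theorem shift_hybrid :
    ∀ {α : Type*} [Fintype α] [DecidableEq α] {ι : Type*} (s : Finset ι) (w : ι → ℝ), (∀ i ∈ s, 0 ≤ w i) → ∀ (Rf : ι → Finset α) (U : (α → Bool) → Bool), Monotone U → ∀ G : ℕ, (∀ (T : Finset α) (e : α), e ∉ T → #((Finset.univ : Finset (α → Bool)).filter fun x => U (fun a => x a || decide (a ∈ insert e T)) = true ∧ U (fun a => x a || decide (a ∈ T)) = false) ≤ G) → ∑ i ∈ s, w i * (#((Finset.univ : Finset (α → Bool)).filter fun x => U (fun a => x a || decide (a ∈ Rf i)) = true) : ℝ) ≤ (∑ i ∈ s, w i) * #((Finset.univ : Finset (α → Bool)).filter fun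 x => U x = true) + (G : ℝ) * ∑ i ∈ s, w i * #(Rf i) :=
  fun s w hw Rf U hU G hG => sum_card_upShift_le_of_gain s w hw Rf U hU G hG

end Summit.PneNP.PneNP.Theorems.MonotoneSuffices.ShiftNoGo
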